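import Literature.Geometry.Riemannian.MCFMetricEvolution
import Literature.Geometry.Lorentzian.VolumeDensityRatio
import HarnessLib

/-!
# The area of a hypersurface moving by mean curvature: `d/dt Area(M_t) = -∫ H² dμ_t`

Topic `Literature/Geometry/Riemannian`. For a classical mean curvature flow `(F, ν)` of a compact
`n`-manifold `N` in `ℝⁿ⁺¹` (`IsClassicalMCF`, `MeanConvexLevelSetFlow.lean`) with induced metrics
`g_t = F_t^*δ` and area measures `μ_t = μ_{g_t}` (`riemannianMeasure`, `Volume.lean`):

* `IsClassicalMCF.hasDerivAt_sqrt_det_gram_localFrame` — the coordinate-frame area density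
  `√D_t(w) = √det (g_t(∂ᵢ, ∂ⱼ))(w)` satisfies `∂ₜ √D_t = -H² √D_t` (`MCFMetricEvolution.lean`);
* `IsClassicalMCF.integral_riemannianMeasure_eq` — `∫ φ dμ_t = ∫ θ_t φ dμ_{t₀}` with the density
  ratio `θ_t = √D_t/√D_{t₀}` (`VolumeDensityRatio.lean`);
* `IsClassicalMCF.hasDerivAt_integral_mul_density` — **differentiation under the integral sign
  along the flow**: for `f, ∂ₜf` jointly continuous on `(a, b) × N`,
  `d/dt|_{t₀} ∫ f(t, ·) θ_t dμ_{t₀} = ∫ (∂ₜf(t₀, ·) - H(t₀, ·)² f(t₀, ·)) dμ_{t₀}`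
  (the derivative is bounded on a compact time slab: `θ_t` is non-increasing in `t` and
  `H² = ‖∂ₜF‖²` is jointly continuous, `IsClassicalMCF.norm_deriv_sq_eq`);
* `IsClassicalMCF.hasDerivAt_area` — **`d/dt|_{t₀} Area(M_t) = -∫ H(t₀, ·)² dμ_{t₀}`**;
* `IsClassicalMCF.hasDerivAt_integral_testFunction` — **Brakke's identity**
  `d/dt ∫_{M_t} φ = -∫ (H dφ(ν) + H² φ) dμ_t` for `C¹` test functions `φ` (classical flows are
  Brakke flows, with equality).

This is the measure-theoretic half of Huisken's monotonicity formula (the other half being the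
pointwise kernel identity, `HuiskenKernelIdentity.lean`, and `∫ Δ_{M_t} ρ = 0`).
Everything is PROVED; no definitions, no named facts.

## References

* G. Huisken, *Flow by mean curvature of convex surfaces into spheres*, J. Differential Geom. 20
  (1984), §3 (evolution of the measure, `d/dt |M_t| = -∫ H²`). [Huisken1984]
* C. Mantegazza, *Lecture Notes on Mean Curvature Flow*, Birkhäuser 2011, Prop. 2.3.3 and
  Cor. 2.3.4. [Mantegazza2011]
-/

noncomputable section

open Bundle Set Function Metric Module Filter MeasureTheory
open scoped Manifold ContDiff Topology RealInnerProductSpace Matrix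

namespace Literature.Geometry.Riemannian

open Lorentzian Lorentzian.PseudoRiemannianMetric EuclideanHypersurface

section AreaDensity

variable {n : ℕ} {N : Type*} [TopologicalSpace N] [ChartedSpace (EuclideanSpace ℝ (Fin n)) N]
  [IsManifold (𝓡 n) ∞ N] {F : ℝ → N → EuclideanSpace ℝ (Fin (n + 1))}
  {ν : (t : ℝ) → NormalField (𝓡 (n + 1)) (F t)} {a b : ℝ}

/-- The Gram matrix of the coordinate frame at `w` (local frame of the trivialisation at `w`) for
the induced form of `F_t` is the Gram matrix of the basis `basisAt`. [folklore] -/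
theorem gram_localFrame_eq_gram_basisAt (f : N → EuclideanSpace ℝ (Fin (n + 1))) (w : N) :
    (Matrix.of fun i j ↦ (euclideanMetric (EuclideanSpace ℝ (Fin (n + 1)))).inducedBilin (𝓡 n) f w
      ((trivializationAt (EuclideanSpace ℝ (Fin n)) (TangentSpace (𝓡 n)) w).localFrame
        (EuclideanSpace.basisFun (Fin n) ℝ).toBasis i w)
      ((trivializationAt (EuclideanSpace ℝ (Fin n)) (TangentSpace (𝓡 n)) w).localFrame
        (EuclideanSpace.basisFun (Fin n) ℝ).toBasis j w)) =
    Matrix.of fun i j ↦ (euclideanMetric (EuclideanSpace ℝ (Fin (n + 1)))).inducedBilin (𝓡 n) f w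
      ((trivializationAt (EuclideanSpace ℝ (Fin n)) (TangentSpace (𝓡 n)) w).basisAt
        (EuclideanSpace.basisFun (Fin n) ℝ).toBasis
          (FiberBundle.mem_baseSet_trivializationAt' w) i)
      ((trivializationAt (EuclideanSpace ℝ (Fin n)) (TangentSpace (𝓡 n)) w).basisAt
        (EuclideanSpace.basisFun (Fin n) ℝ).toBasis
          (FiberBundle.mem_baseSet_trivializationAt' w) j) := by
  ext i j
  rw [Matrix.of_apply, Matrix.of_apply,
    Trivialization.localFrame_apply_of_mem_baseSet _ _ (FiberBundle.mem_baseSet_trivializationAt' w),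
    Trivialization.localFrame_apply_of_mem_baseSet _ _ (FiberBundle.mem_baseSet_trivializationAt' w)]

/-- **Pointwise evolution of the area density**: for a classical mean curvature flow and
`t₁ ∈ [a, b]`, the coordinate-frame Gram determinant `D_t(w) = det (g_t(∂ᵢ, ∂ⱼ))(w)` satisfies
`d/dt|_{t₁} √D_t(w) = -H(t₁, w)² √D_{t₁}(w)` (`IsClassicalMCF.hasDerivAt_sqrt_det_gram` for the
basis of the trivialisation at `w`). [cite: Huisken1984, Lemma 3.2] [cite: Mantegazza2011, Prop. 2.3.3] -/
theorem IsClassicalMCF.hasDerivAt_sqrt_det_gram_localFrame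
    (h : IsClassicalMCF (euclideanMetric (EuclideanSpace ℝ (Fin (n + 1)))) F ν a b) {t₁ : ℝ}
    (ht₁ : t₁ ∈ Icc a b) (w : N) :
    HasDerivAt (fun t ↦ Real.sqrt (Matrix.of fun i j ↦
        (euclideanMetric (EuclideanSpace ℝ (Fin (n + 1)))).inducedBilin (𝓡 n) (F t) w
          ((trivializationAt (EuclideanSpace ℝ (Fin n)) (TangentSpace (𝓡 n)) w).localFrame
            (EuclideanSpace.basisFun (Fin n) ℝ).toBasis i w)
          ((trivializationAt (EuclideanSpace ℝ (Fin n)) (TangentSpace (𝓡 n)) w).localFrame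
            (EuclideanSpace.basisFun (Fin n) ℝ).toBasis j w)).det)
      (-((euclideanMetric _).meanCurvature (F t₁) contMDiff_pullbackBilin_holds
          (h.isSpacelikeImmersion t₁ ht₁) (ν t₁) w) ^ 2 *
        Real.sqrt (Matrix.of fun i j ↦
          (euclideanMetric (EuclideanSpace ℝ (Fin (n + 1)))).inducedBilin (𝓡 n) (F t₁) w
            ((trivializationAt (EuclideanSpace ℝ (Fin n)) (TangentSpace (𝓡 n)) w).localFrame
              (EuclideanSpace.basisFun (Fin n) ℝ).toBasis i w)
            ((trivializationAt (EuclideanSpace ℝ (Fin n)) (TangentSpace (𝓡 n)) w).localFrame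
              (EuclideanSpace.basisFun (Fin n) ℝ).toBasis j w)).det) t₁ := by
  simp_rw [gram_localFrame_eq_gram_basisAt]
  exact h.hasDerivAt_sqrt_det_gram ht₁ w _

/-- **The chart density of the induced metric `g_t` at the centre of its own chart is the
coordinate-frame Gram determinant.** [folklore] -/
theorem chartGramMatrix_inducedRiemannianMetric_self
    {f : N → EuclideanSpace ℝ (Fin (n + 1))}
    (hf : (euclideanMetric (EuclideanSpace ℝ (Fin (n + 1)))).IsSpacelikeImmersion (𝓡 n) f) (w : N) :
    chartGramMatrix ((euclideanMetric (EuclideanSpace ℝ (Fin (n + 1)))).inducedRiemannianMetric f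
        contMDiff_pullbackBilin_holds hf) w (extChartAt (𝓡 n) w w) =
      Matrix.of fun i j ↦ (euclideanMetric (EuclideanSpace ℝ (Fin (n + 1)))).inducedBilin (𝓡 n) f w
        ((trivializationAt (EuclideanSpace ℝ (Fin n)) (TangentSpace (𝓡 n)) w).localFrame
          (EuclideanSpace.basisFun (Fin n) ℝ).toBasis i w)
        ((trivializationAt (EuclideanSpace ℝ (Fin n)) (TangentSpace (𝓡 n)) w).localFrame
          (EuclideanSpace.basisFun (Fin n) ℝ).toBasis j w) := by
  rw [chartGramMatrix_eq_gram_localFrame _ w (mem_extChartAt_target w), extChartAt_to_inv (I := 𝓡 n) w]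
  rfl

end AreaDensity


section AreaEvolution

variable {n : ℕ} {N : Type*} [TopologicalSpace N] [ChartedSpace (EuclideanSpace ℝ (Fin n)) N]
  [IsManifold (𝓡 n) ∞ N] [CompactSpace N] [T2Space N] [MeasurableSpace N] [BorelSpace N]
  {F : ℝ → N → EuclideanSpace ℝ (Fin (n + 1))}
  {ν : (t : ℝ) → NormalField (𝓡 (n + 1)) (F t)} {a b : ℝ}

omit [CompactSpace N] [T2Space N] [MeasurableSpace N] [BorelSpace N] in
/-- `‖∂ₜF‖² = H²` along a classical mean curvature flow (`∂ₜF = -Hν`, `‖ν‖ = 1`); in particular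
`H²` is jointly continuous in `(t, y)`. [folklore] -/
theorem IsClassicalMCF.norm_deriv_sq_eq
    (h : IsClassicalMCF (euclideanMetric (EuclideanSpace ℝ (Fin (n + 1)))) F ν a b) {t : ℝ}
    (ht : t ∈ Icc a b) (y : N) :
    ‖deriv (fun s ↦ F s y) t‖ ^ 2 =
      ((euclideanMetric _).meanCurvature (F t) contMDiff_pullbackBilin_holds
        (h.isSpacelikeImmersion t ht) (ν t) y) ^ 2 := by
  set w : EuclideanSpace ℝ (Fin (n + 1)) := ν t y with hw
  set H₁ : ℝ := (euclideanMetric _).meanCurvature (F t) contMDiff_pullbackBilin_holds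
    (h.isSpacelikeImmersion t ht) (ν t) y with hH₁
  have hv : deriv (fun s ↦ F s y) t = (-H₁) • w := by
    rw [← mfderiv_slice_apply_one]
    exact h.velocity_eq t ht y
  have hν : ⟪w, w⟫ = (1 : ℝ) := (h.isUnitNormal t ht).val_self y
  rw [hv, norm_smul, mul_pow, ← real_inner_self_eq_norm_sq w, hν, Real.norm_eq_abs, sq_abs, mul_one, neg_sq]

/-- **Differentiation of `∫ f(t, ·) dμ_t` along a mean curvature flow** (the measure written
against the fixed measure `μ_{t₀}` with the density `θ_t = √D_t/√D_{t₀}` of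
`VolumeDensityRatio.lean`): for `t₀ ∈ (a, b)` and `f, ∂ₜf` jointly continuous on `(a, b) × N`,

  `d/dt|_{t₀} ∫_N f(t, w) θ_t(w) dμ_{t₀}(w) = ∫_N (∂ₜf(t₀, w) - H(t₀, w)² f(t₀, w)) dμ_{t₀}(w)`

(`∂ₜθ_t = -H²θ_t`, `θ_{t₀} = 1`; differentiation under the integral sign, the derivative being
bounded on a compact time slab: `θ_t` is non-increasing in `t`, `H² = ‖∂ₜF‖²` is jointly
continuous). Huisken 1984, proof of Thm. 3.1 / Mantegazza 2011, Prop. 2.3.3 and §3.2.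
[cite: Huisken1984, §3] [cite: Mantegazza2011, Prop. 2.3.3] -/
theorem IsClassicalMCF.hasDerivAt_integral_mul_density
    (h : IsClassicalMCF (euclideanMetric (EuclideanSpace ℝ (Fin (n + 1)))) F ν a b) {t₀ : ℝ}
    (ht₀ : t₀ ∈ Ioo a b) {f f' : ℝ → N → ℝ}
    (hfc : ContinuousOn (uncurry f) (Ioo a b ×ˢ univ))
    (hf'c : ContinuousOn (uncurry f') (Ioo a b ×ˢ univ))
    (hfd : ∀ t ∈ Ioo a b, ∀ w, HasDerivAt (fun s ↦ f s w) (f' t w) t) :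
    HasDerivAt (fun t ↦ ∫ w, f t w *
        (Real.sqrt (Matrix.of fun i j ↦
          (euclideanMetric (EuclideanSpace ℝ (Fin (n + 1)))).inducedBilin (𝓡 n) (F t) w
            ((trivializationAt (EuclideanSpace ℝ (Fin n)) (TangentSpace (𝓡 n)) w).localFrame
              (EuclideanSpace.basisFun (Fin n) ℝ).toBasis i w)
            ((trivializationAt (EuclideanSpace ℝ (Fin n)) (TangentSpace (𝓡 n)) w).localFrame
              (EuclideanSpace.basisFun (Fin n) ℝ).toBasis j w)).det /
         Real.sqrt (Matrix.of fun i j ↦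
          (euclideanMetric (EuclideanSpace ℝ (Fin (n + 1)))).inducedBilin (𝓡 n) (F t₀) w
            ((trivializationAt (EuclideanSpace ℝ (Fin n)) (TangentSpace (𝓡 n)) w).localFrame
              (EuclideanSpace.basisFun (Fin n) ℝ).toBasis i w)
            ((trivializationAt (EuclideanSpace ℝ (Fin n)) (TangentSpace (𝓡 n)) w).localFrame
              (EuclideanSpace.basisFun (Fin n) ℝ).toBasis j w)).det)
        ∂riemannianMeasure ((euclideanMetric (EuclideanSpace ℝ (Fin (n + 1)))).inducedRiemannianMetric
          (F t₀) contMDiff_pullbackBilin_holds (h.isSpacelikeImmersion t₀ (Ioo_subset_Icc_self ht₀))))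
      (∫ w, (f' t₀ w - ((euclideanMetric _).meanCurvature (F t₀) contMDiff_pullbackBilin_holds
          (h.isSpacelikeImmersion t₀ (Ioo_subset_Icc_self ht₀)) (ν t₀) w) ^ 2 * f t₀ w)
        ∂riemannianMeasure ((euclideanMetric (EuclideanSpace ℝ (Fin (n + 1)))).inducedRiemannianMetric
          (F t₀) contMDiff_pullbackBilin_holds (h.isSpacelikeImmersion t₀ (Ioo_subset_Icc_self ht₀))))
      t₀ := by
  obtain ⟨U, hU, hIU, hF⟩ := h.contMDiffOn
  have ht₀' : t₀ ∈ Icc a b := Ioo_subset_Icc_self ht₀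
  -- notation: the metrics, the reference measure, the densities
  set g : ∀ t, t ∈ Icc a b → ContMDiffRiemannianMetric (𝓡 n) ∞ (EuclideanSpace ℝ (Fin n))
      (TangentSpace (𝓡 n) : N → Type _) := fun t ht ↦
    (euclideanMetric (EuclideanSpace ℝ (Fin (n + 1)))).inducedRiemannianMetric (F t)
      contMDiff_pullbackBilin_holds (h.isSpacelikeImmersion t ht) with hg
  set μ₀ := riemannianMeasure (g t₀ ht₀') with hμ₀
  haveI : IsFiniteMeasure μ₀ := isFiniteMeasure_riemannianMeasure _
  set D : ℝ → N → ℝ := fun t w ↦ (Matrix.of fun i j ↦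
    (euclideanMetric (EuclideanSpace ℝ (Fin (n + 1)))).inducedBilin (𝓡 n) (F t) w
      ((trivializationAt (EuclideanSpace ℝ (Fin n)) (TangentSpace (𝓡 n)) w).localFrame
        (EuclideanSpace.basisFun (Fin n) ℝ).toBasis i w)
      ((trivializationAt (EuclideanSpace ℝ (Fin n)) (TangentSpace (𝓡 n)) w).localFrame
        (EuclideanSpace.basisFun (Fin n) ℝ).toBasis j w)).det with hD
  set θ : ℝ → N → ℝ := fun t w ↦ Real.sqrt (D t w) / Real.sqrt (D t₀ w) with hθ
  set Hm : ∀ t, t ∈ Icc a b → N → ℝ := fun t ht w ↦ (euclideanMetric _).meanCurvature (F t)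
    contMDiff_pullbackBilin_holds (h.isSpacelikeImmersion t ht) (ν t) w with hHm
  set Hsq : ℝ → N → ℝ := fun t w ↦ ‖deriv (fun s ↦ F s w) t‖ ^ 2 with hHsq
  -- (1) the densities: chart identification, positivity, continuity, derivative
  have hDchart : ∀ t (ht : t ∈ Icc a b) w,
      chartGramMatrix (g t ht) w (extChartAt (𝓡 n) w w) = Matrix.of fun i j ↦
        (euclideanMetric (EuclideanSpace ℝ (Fin (n + 1)))).inducedBilin (𝓡 n) (F t) w
          ((trivializationAt (EuclideanSpace ℝ (Fin n)) (TangentSpace (𝓡 n)) w).localFrame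
            (EuclideanSpace.basisFun (Fin n) ℝ).toBasis i w)
          ((trivializationAt (EuclideanSpace ℝ (Fin n)) (TangentSpace (𝓡 n)) w).localFrame
            (EuclideanSpace.basisFun (Fin n) ℝ).toBasis j w) :=
    fun t ht w ↦ chartGramMatrix_inducedRiemannianMetric_self (h.isSpacelikeImmersion t ht) w
  have hDpos : ∀ t (ht : t ∈ Icc a b) w, 0 < Real.sqrt (D t w) := fun t ht w ↦ by
    have := sqrt_det_chartGramMatrix_pos (g t ht) w (mem_extChartAt_target w)
    rwa [hDchart t ht w] at this
  have hθcan : ∀ t (ht : t ∈ Icc a b), θ t = fun w ↦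
      Real.sqrt (chartGramMatrix (g t ht) w (extChartAt (𝓡 n) w w)).det /
        Real.sqrt (chartGramMatrix (g t₀ ht₀') w (extChartAt (𝓡 n) w w)).det := fun t ht ↦ by
    funext w
    simp only [hθ, hD, hDchart t ht w, hDchart t₀ ht₀' w]
  have hθcont : ∀ t (ht : t ∈ Icc a b), Continuous (θ t) := fun t ht ↦ by
    rw [hθcan t ht]
    exact continuous_sqrt_det_chartGramMatrix_div (g t ht) (g t₀ ht₀')
  have hθpos : ∀ t (ht : t ∈ Icc a b) w, 0 < θ t w := fun t ht w ↦
    div_pos (hDpos t ht w) (hDpos t₀ ht₀' w)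
  have hθ₀ : ∀ w, θ t₀ w = 1 := fun w ↦ div_self (hDpos t₀ ht₀' w).ne'
  have hθd : ∀ t (ht : t ∈ Icc a b) w, HasDerivAt (fun s ↦ θ s w) (-(Hm t ht w) ^ 2 * θ t w) t :=
    fun t ht w ↦ by
    have hd := (h.hasDerivAt_sqrt_det_gram_localFrame ht w).div_const (Real.sqrt (D t₀ w))
    simp only [hθ]
    refine hd.congr_deriv ?_
    simp only [hHm, hD]
    ring
  -- (2) `H² = ‖∂ₜF‖²` is jointly continuous
  have hHsq : ∀ t (ht : t ∈ Icc a b) w, Hsq t w = Hm t ht w ^ 2 := fun t ht w ↦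
    h.norm_deriv_sq_eq ht w
  have hHsqc : ContinuousOn (uncurry Hsq) (U ×ˢ univ) :=
    ((continuousOn_timeDeriv hU hF).norm).pow 2
  have hHsq0 : ∀ t w, 0 ≤ Hsq t w := fun t w ↦ by positivity
  -- freeze the let-bound abbreviations (their bodies are no longer needed; this keeps later
  -- definitional unfolding cheap)
  clear_value Hsq θ D
  -- (3) a compact time slab around `t₀`
  obtain ⟨δ, hδ, hslab⟩ : ∃ δ > 0, Icc (t₀ - δ) (t₀ + δ) ⊆ Ioo a b := by
    refine ⟨min (t₀ - a) (b - t₀) / 2, by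
      have := ht₀.1; have := ht₀.2; positivity, fun t ht ↦ ⟨?_, ?_⟩⟩
    · have h1 : min (t₀ - a) (b - t₀) ≤ t₀ - a := min_le_left _ _
      linarith [ht.1, ht₀.1, ht₀.2]
    · have h2 : min (t₀ - a) (b - t₀) ≤ b - t₀ := min_le_right _ _
      linarith [ht.2, ht₀.1, ht₀.2]
  have hslab' : Icc (t₀ - δ) (t₀ + δ) ⊆ Icc a b := hslab.trans Ioo_subset_Icc_self
  have hK : IsCompact (Icc (t₀ - δ) (t₀ + δ) ×ˢ (univ : Set N)) := isCompact_Icc.prod isCompact_univ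
  -- bounds: `|f'| ≤ C₁`, `|f| ≤ C₀`, `H² ≤ C₂` on the slab, `θ ≤ M`
  obtain ⟨C₀, hC₀⟩ := hK.exists_bound_of_continuousOn (hfc.mono (Set.prod_mono hslab subset_rfl))
  obtain ⟨C₁, hC₁⟩ := hK.exists_bound_of_continuousOn (hf'c.mono (Set.prod_mono hslab subset_rfl))
  obtain ⟨C₂, hC₂⟩ := hK.exists_bound_of_continuousOn
    (hHsqc.mono (Set.prod_mono (hslab'.trans hIU) subset_rfl))
  have htδ : t₀ - δ ∈ Icc a b := hslab' ⟨le_rfl, by linarith⟩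
  obtain ⟨M, hM⟩ := (isCompact_univ (X := N)).exists_bound_of_continuousOn
    (hθcont (t₀ - δ) htδ).continuousOn
  -- `θ` is non-increasing in `t` on `[a, b]`
  have hθd' : ∀ t (ht : t ∈ Icc a b) w, HasDerivAt (fun s ↦ θ s w) (-(Hsq t w) * θ t w) t :=
    fun t ht w ↦ (hθd t ht w).congr_deriv (by rw [hHsq t ht w])
  have hθanti : ∀ w, AntitoneOn (fun s ↦ θ s w) (Icc a b) := fun w ↦ by
    refine antitoneOn_of_hasDerivWithinAt_nonpos (convex_Icc a b) (f' := fun t ↦ -(Hsq t w) * θ t w)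
      (fun t ht ↦ (hθd t ht w).continuousAt.continuousWithinAt)
      (fun t ht ↦ (hθd' t (interior_subset ht) w).hasDerivWithinAt) fun t ht ↦ ?_
    have h1 := hθpos t (interior_subset ht) w
    have h2 : 0 ≤ Hsq t w := hHsq0 t w
    nlinarith
  have hθle : ∀ t ∈ Icc (t₀ - δ) (t₀ + δ), ∀ w, θ t w ≤ M := fun t ht w ↦ by
    have h1 : θ t w ≤ θ (t₀ - δ) w := hθanti w htδ (hslab' ht) ht.1
    have h2 : θ (t₀ - δ) w ≤ M := by
      have := hM w (mem_univ w)
      rw [Real.norm_eq_abs] at this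
      exact (le_abs_self _).trans this
    exact h1.trans h2
  -- (4) differentiation under the integral sign
  have hcontt : ∀ t ∈ Ioo a b, Continuous (f t) := fun t ht ↦
    hfc.comp_continuous (continuous_const.prodMk continuous_id) fun y ↦ ⟨ht, mem_univ _⟩
  have hcontt' : ∀ t ∈ Ioo a b, Continuous (f' t) := fun t ht ↦
    hf'c.comp_continuous (continuous_const.prodMk continuous_id) fun y ↦ ⟨ht, mem_univ _⟩
  have hHsqt : ∀ t ∈ Icc a b, Continuous (Hsq t) := fun t ht ↦
    hHsqc.comp_continuous (continuous_const.prodMk continuous_id) fun y ↦ ⟨hIU ht, mem_univ _⟩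
  set C : ℝ := C₁ * M + C₀ * (C₂ * M) with hC
  have hΦ := hasDerivAt_integral_of_dominated_loc_of_deriv_le (μ := μ₀)
    (F := fun t w ↦ f t w * θ t w)
    (F' := fun t w ↦ f' t w * θ t w + f t w * (-(Hsq t w) * θ t w))
    (x₀ := t₀) (s := Ioo (t₀ - δ) (t₀ + δ)) (bound := fun _ ↦ C)
    (Ioo_mem_nhds (by linarith) (by linarith))
    (by
      filter_upwards [isOpen_Ioo.mem_nhds ht₀] with t ht
      exact ((hcontt t ht).mul (hθcont t (Ioo_subset_Icc_self ht))).aestronglyMeasurable)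
    (integrable_of_continuous (h := g t₀ ht₀') ((hcontt t₀ ht₀).mul (hθcont t₀ ht₀')))
    ((((hcontt' t₀ ht₀).mul (hθcont t₀ ht₀')).add ((hcontt t₀ ht₀).mul
      (((hHsqt t₀ ht₀').neg).mul (hθcont t₀ ht₀')))).aestronglyMeasurable)
    (Eventually.of_forall fun w t ht ↦ by
      have ht' : t ∈ Icc (t₀ - δ) (t₀ + δ) := Ioo_subset_Icc_self ht
      have h0 := hC₀ (t, w) ⟨ht', mem_univ _⟩
      have h1 := hC₁ (t, w) ⟨ht', mem_univ _⟩
      have h2 := hC₂ (t, w) ⟨ht', mem_univ _⟩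
      simp only [uncurry_apply_pair, Real.norm_eq_abs] at h0 h1 h2
      have hθw := hθle t ht' w
      have hθ0 := (hθpos t (hslab' ht') w).le
      have hH0 : 0 ≤ Hsq t w := hHsq0 t w
      have hC2' : Hsq t w ≤ C₂ := (le_abs_self _).trans h2
      have hC₁0 : 0 ≤ C₁ := (abs_nonneg _).trans h1
      have hC₀0 : 0 ≤ C₀ := (abs_nonneg _).trans h0
      have hC₂0 : 0 ≤ C₂ := hH0.trans hC2'
      rw [Real.norm_eq_abs]
      calc |f' t w * θ t w + f t w * (-(Hsq t w) * θ t w)|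
          ≤ |f' t w * θ t w| + |f t w * (-(Hsq t w) * θ t w)| := abs_add_le _ _
        _ = |f' t w| * θ t w + |f t w| * (Hsq t w * θ t w) := by
            rw [abs_mul, abs_mul, abs_of_nonneg hθ0, neg_mul, abs_neg,
              abs_of_nonneg (mul_nonneg hH0 hθ0)]
        _ ≤ C₁ * M + C₀ * (C₂ * M) :=
            add_le_add (mul_le_mul h1 hθw hθ0 hC₁0)
              (mul_le_mul h0 (mul_le_mul hC2' hθw hθ0 hC₂0) (mul_nonneg hH0 hθ0) hC₀0))
    (integrable_const C)
    (Eventually.of_forall fun w t ht ↦ by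
      have ht' : t ∈ Icc a b := hslab' (Ioo_subset_Icc_self ht)
      have hprod := (hfd t (hslab (Ioo_subset_Icc_self ht)) w).mul (hθd t ht' w)
      refine hprod.congr_deriv ?_
      rw [hHsq t ht' w])
  obtain ⟨-, hΦ2⟩ := hΦ
  have key : HasDerivAt (fun t ↦ ∫ w, f t w * θ t w ∂μ₀)
      (∫ w, (f' t₀ w - Hm t₀ ht₀' w ^ 2 * f t₀ w) ∂μ₀) t₀ := by
    refine hΦ2.congr_deriv ?_
    refine integral_congr_ae (Eventually.of_forall fun w ↦ ?_)
    simp only [hθ₀ w, hHsq t₀ ht₀' w]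
    ring
  simp only [hθ, hD] at key
  exact key


/-- **`∫ φ dμ_t = ∫ θ_t φ dμ_{t₀}`**: integration against the area measure of `g_t = F_t^*δ` is
integration of `θ_t φ` against that of `g_{t₀}`, `θ_t = √D_t/√D_{t₀}` the coordinate-frame
density ratio (`integral_riemannianMeasure_eq_integral_mul`, `VolumeDensityRatio.lean`).
[cite: Mantegazza2011, Prop. 2.3.3] -/
theorem IsClassicalMCF.integral_riemannianMeasure_eq
    (h : IsClassicalMCF (euclideanMetric (EuclideanSpace ℝ (Fin (n + 1)))) F ν a b) {t t₀ : ℝ}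
    (ht : t ∈ Icc a b) (ht₀ : t₀ ∈ Icc a b) {E : Type*} [NormedAddCommGroup E] [NormedSpace ℝ E]
    (φ : N → E) :
    ∫ w, φ w ∂riemannianMeasure ((euclideanMetric (EuclideanSpace ℝ (Fin (n + 1)))).inducedRiemannianMetric
        (F t) contMDiff_pullbackBilin_holds (h.isSpacelikeImmersion t ht)) =
      ∫ w, (Real.sqrt (Matrix.of fun i j ↦
          (euclideanMetric (EuclideanSpace ℝ (Fin (n + 1)))).inducedBilin (𝓡 n) (F t) w
            ((trivializationAt (EuclideanSpace ℝ (Fin n)) (TangentSpace (𝓡 n)) w).localFrame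
              (EuclideanSpace.basisFun (Fin n) ℝ).toBasis i w)
            ((trivializationAt (EuclideanSpace ℝ (Fin n)) (TangentSpace (𝓡 n)) w).localFrame
              (EuclideanSpace.basisFun (Fin n) ℝ).toBasis j w)).det /
         Real.sqrt (Matrix.of fun i j ↦
          (euclideanMetric (EuclideanSpace ℝ (Fin (n + 1)))).inducedBilin (𝓡 n) (F t₀) w
            ((trivializationAt (EuclideanSpace ℝ (Fin n)) (TangentSpace (𝓡 n)) w).localFrame
              (EuclideanSpace.basisFun (Fin n) ℝ).toBasis i w)
            ((trivializationAt (EuclideanSpace ℝ (Fin n)) (TangentSpace (𝓡 n)) w).localFrame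
              (EuclideanSpace.basisFun (Fin n) ℝ).toBasis j w)).det) • φ w
        ∂riemannianMeasure ((euclideanMetric (EuclideanSpace ℝ (Fin (n + 1)))).inducedRiemannianMetric
          (F t₀) contMDiff_pullbackBilin_holds (h.isSpacelikeImmersion t₀ ht₀)) := by
  rw [integral_riemannianMeasure_eq_integral_mul]
  refine integral_congr_ae (Eventually.of_forall fun w ↦ ?_)
  simp only [chartGramMatrix_inducedRiemannianMetric_self]

/-- **The area of the evolving hypersurface decreases at the rate `∫ H²`**: with
`A(t) = ∫_N θ_t dμ_{t₀}` (`= μ_t(N)` for `t ∈ [a, b]`, `integral_riemannianMeasure_eq` with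
`φ ≡ 1`), `A'(t₀) = -∫_N H(t₀, ·)² dμ_{t₀}` (Huisken 1984; Mantegazza 2011, Prop. 2.3.3 /
Cor. 2.3.4: `d/dt Area(M_t) = -∫ H² dμ_t`). [cite: Huisken1984, §3] [cite: Mantegazza2011, Prop. 2.3.3] -/
theorem IsClassicalMCF.hasDerivAt_area
    (h : IsClassicalMCF (euclideanMetric (EuclideanSpace ℝ (Fin (n + 1)))) F ν a b) {t₀ : ℝ}
    (ht₀ : t₀ ∈ Ioo a b) :
    HasDerivAt (fun t ↦ ∫ w,
        (Real.sqrt (Matrix.of fun i j ↦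
          (euclideanMetric (EuclideanSpace ℝ (Fin (n + 1)))).inducedBilin (𝓡 n) (F t) w
            ((trivializationAt (EuclideanSpace ℝ (Fin n)) (TangentSpace (𝓡 n)) w).localFrame
              (EuclideanSpace.basisFun (Fin n) ℝ).toBasis i w)
            ((trivializationAt (EuclideanSpace ℝ (Fin n)) (TangentSpace (𝓡 n)) w).localFrame
              (EuclideanSpace.basisFun (Fin n) ℝ).toBasis j w)).det /
         Real.sqrt (Matrix.of fun i j ↦
          (euclideanMetric (EuclideanSpace ℝ (Fin (n + 1)))).inducedBilin (𝓡 n) (F t₀) w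
            ((trivializationAt (EuclideanSpace ℝ (Fin n)) (TangentSpace (𝓡 n)) w).localFrame
              (EuclideanSpace.basisFun (Fin n) ℝ).toBasis i w)
            ((trivializationAt (EuclideanSpace ℝ (Fin n)) (TangentSpace (𝓡 n)) w).localFrame
              (EuclideanSpace.basisFun (Fin n) ℝ).toBasis j w)).det)
        ∂riemannianMeasure ((euclideanMetric (EuclideanSpace ℝ (Fin (n + 1)))).inducedRiemannianMetric
          (F t₀) contMDiff_pullbackBilin_holds (h.isSpacelikeImmersion t₀ (Ioo_subset_Icc_self ht₀))))
      (-∫ w, ((euclideanMetric _).meanCurvature (F t₀) contMDiff_pullbackBilin_holds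
          (h.isSpacelikeImmersion t₀ (Ioo_subset_Icc_self ht₀)) (ν t₀) w) ^ 2
        ∂riemannianMeasure ((euclideanMetric (EuclideanSpace ℝ (Fin (n + 1)))).inducedRiemannianMetric
          (F t₀) contMDiff_pullbackBilin_holds (h.isSpacelikeImmersion t₀ (Ioo_subset_Icc_self ht₀))))
      t₀ := by
  have hmain := h.hasDerivAt_integral_mul_density ht₀ (f := fun _ _ ↦ (1 : ℝ)) (f' := fun _ _ ↦ (0 : ℝ))
    continuousOn_const continuousOn_const (fun t _ w ↦ hasDerivAt_const t (1 : ℝ))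
  simp only [one_mul, mul_one, zero_sub] at hmain
  rw [integral_neg] at hmain
  exact hmain

end AreaEvolution

/-! ### Brakke's identity: classical flows are Brakke flows -/

section Brakke

variable {n : ℕ} {N : Type*} [TopologicalSpace N] [ChartedSpace (EuclideanSpace ℝ (Fin n)) N]
  [IsManifold (𝓡 n) ∞ N] [CompactSpace N] [T2Space N] [MeasurableSpace N] [BorelSpace N]
  {F : ℝ → N → EuclideanSpace ℝ (Fin (n + 1))}
  {ν : (t : ℝ) → NormalField (𝓡 (n + 1)) (F t)} {a b : ℝ}

/-- **Brakke's identity for a classical mean curvature flow** (the defining (in)equality of a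
Brakke flow, with equality): for a `C¹` test function `φ` on `ℝⁿ⁺¹` and `t₀ ∈ (a, b)`,

  `d/dt|_{t₀} ∫_{M_t} φ dμ_t = -∫_N (H dφ(ν) + H² φ)(F_{t₀}) dμ_{t₀}`

(`∫_{M_t} φ dμ_t` written as `∫_N φ(F_t) θ_t dμ_{t₀}`; `MCFAreaEvolution` with `f = φ ∘ F`,
`∂ₜf = dφ(∂ₜF) = -H dφ(ν)`). Brakke 1978, §3; Ilmanen 1994, §6 (smooth flows are Brakke flows).
[cite: Mantegazza2011, Prop. 2.3.3] [cite: Huisken1984, §3] -/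
theorem IsClassicalMCF.hasDerivAt_integral_testFunction
    (h : IsClassicalMCF (euclideanMetric (EuclideanSpace ℝ (Fin (n + 1)))) F ν a b) {t₀ : ℝ}
    (ht₀ : t₀ ∈ Ioo a b) {φ : EuclideanSpace ℝ (Fin (n + 1)) → ℝ} (hφ : ContDiff ℝ 1 φ) :
    HasDerivAt (fun t ↦ ∫ w, φ (F t w) *
        (Real.sqrt (Matrix.of fun i j ↦
          (euclideanMetric (EuclideanSpace ℝ (Fin (n + 1)))).inducedBilin (𝓡 n) (F t) w
            ((trivializationAt (EuclideanSpace ℝ (Fin n)) (TangentSpace (𝓡 n)) w).localFrame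
              (EuclideanSpace.basisFun (Fin n) ℝ).toBasis i w)
            ((trivializationAt (EuclideanSpace ℝ (Fin n)) (TangentSpace (𝓡 n)) w).localFrame
              (EuclideanSpace.basisFun (Fin n) ℝ).toBasis j w)).det /
         Real.sqrt (Matrix.of fun i j ↦
          (euclideanMetric (EuclideanSpace ℝ (Fin (n + 1)))).inducedBilin (𝓡 n) (F t₀) w
            ((trivializationAt (EuclideanSpace ℝ (Fin n)) (TangentSpace (𝓡 n)) w).localFrame
              (EuclideanSpace.basisFun (Fin n) ℝ).toBasis i w)
            ((trivializationAt (EuclideanSpace ℝ (Fin n)) (TangentSpace (𝓡 n)) w).localFrame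
              (EuclideanSpace.basisFun (Fin n) ℝ).toBasis j w)).det)
        ∂riemannianMeasure ((euclideanMetric (EuclideanSpace ℝ (Fin (n + 1)))).inducedRiemannianMetric
          (F t₀) contMDiff_pullbackBilin_holds (h.isSpacelikeImmersion t₀ (Ioo_subset_Icc_self ht₀))))
      (-∫ w, ((euclideanMetric _).meanCurvature (F t₀) contMDiff_pullbackBilin_holds
            (h.isSpacelikeImmersion t₀ (Ioo_subset_Icc_self ht₀)) (ν t₀) w *
          fderiv ℝ φ (F t₀ w) (ν t₀ w) +
        ((euclideanMetric _).meanCurvature (F t₀) contMDiff_pullbackBilin_holds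
            (h.isSpacelikeImmersion t₀ (Ioo_subset_Icc_self ht₀)) (ν t₀) w) ^ 2 * φ (F t₀ w))
        ∂riemannianMeasure ((euclideanMetric (EuclideanSpace ℝ (Fin (n + 1)))).inducedRiemannianMetric
          (F t₀) contMDiff_pullbackBilin_holds (h.isSpacelikeImmersion t₀ (Ioo_subset_Icc_self ht₀))))
      t₀ := by
  obtain ⟨U, hU, hIU, hF⟩ := h.contMDiffOn
  have ht₀' : t₀ ∈ Icc a b := Ioo_subset_Icc_self ht₀
  have hFc : ContinuousOn (fun q : ℝ × N ↦ F q.1 q.2) (Ioo a b ×ˢ univ) :=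
    hF.continuousOn.mono (Set.prod_mono (Ioo_subset_Icc_self.trans hIU) subset_rfl)
  have hDc : ContinuousOn (fun q : ℝ × N ↦ deriv (fun s ↦ F s q.2) q.1) (Ioo a b ×ˢ univ) :=
    (continuousOn_timeDeriv hU hF).mono (Set.prod_mono (Ioo_subset_Icc_self.trans hIU) subset_rfl)
  have hfc : ContinuousOn (uncurry fun t w ↦ φ (F t w)) (Ioo a b ×ˢ univ) :=
    hφ.continuous.comp_continuousOn hFc
  have hf'c : ContinuousOn (uncurry fun t w ↦ fderiv ℝ φ (F t w) (deriv (fun s ↦ F s w) t))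
      (Ioo a b ×ˢ univ) :=
    ((hφ.continuous_fderiv one_ne_zero).comp_continuousOn hFc).clm_apply hDc
  have hfd : ∀ t ∈ Ioo a b, ∀ w, HasDerivAt (fun s ↦ φ (F s w))
      (fderiv ℝ φ (F t w) (deriv (fun s ↦ F s w) t)) t := fun t ht w ↦
    ((hφ.differentiable one_ne_zero (F t w)).hasFDerivAt).comp_hasDerivAt t
      (hasDerivAt_slice hU hF (hIU (Ioo_subset_Icc_self ht)) w)
  have hmain := h.hasDerivAt_integral_mul_density ht₀ hfc hf'c hfd
  refine hmain.congr_deriv ?_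
  rw [← integral_neg]
  refine integral_congr_ae (Eventually.of_forall fun w ↦ ?_)
  beta_reduce
  set wν : EuclideanSpace ℝ (Fin (n + 1)) := ν t₀ w with hwν
  set H₁ : ℝ := (euclideanMetric _).meanCurvature (F t₀) contMDiff_pullbackBilin_holds
    (h.isSpacelikeImmersion t₀ ht₀') (ν t₀) w with hH₁
  have hv : deriv (fun s ↦ F s w) t₀ = (-H₁) • wν := by
    rw [← mfderiv_slice_apply_one]
    exact h.velocity_eq t₀ ht₀' w
  rw [hv, map_smul, smul_eq_mul]
  ring

end Brakke

end Literature.Geometry.Riemannian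

end
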